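import Mathlib
import HarnessLib
import Summits.Ventures.LatticeQCDFlow.Scaling.CharFunTaylorBound

/-!
# LatticeQCDFlow / Scaling — Lindeberg's truncated third-order bound on a characteristic function

HONEST FRAMING: exact (Metropolis-corrected) sampling algorithms for lattice gauge theory;
figures of merit are autocorrelation/cost numbers at stated couplings and volumes; no
continuum-physics claim.

Venture `LatticeQCDFlow` (cell pub-lqcd), topic `Scaling`; FANOUT row 3 (`s0-u1-a`, S0-B
implementation A, GEN-19).  NEW WORK of the cell (tool for row 3's Lindeberg row CLT
`Scaling/LindebergRowCLT`, on top of `Scaling/CharFunTaylorBound`); NO definition is introduced;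
nothing is cited (Lindeberg 1922 NAMED ONLY).

* **`norm_charFun_map_sub_taylor_le_trunc`** — for a centred square-integrable statistic `h` under a
  probability law and every truncation level `M ≥ 0`:
  `‖φ(u) − (1 − u²·E h²/2)‖ ≤ |u|³·M·E h² + (3/2)·u²·E[h²; |h| > M]`
  (third-order bound `|x|³` on `{|h| ≤ M}`, second-order bound `(3/2)x²` on `{|h| > M}`);
* `integral_sq_le_sq_add_trunc` — Feller's `E h² ≤ M² + E[h²; |h| > M]`.

NOT CLAIMED: sharp constants; nothing re-scored.
-/

noncomputable section

namespace Summit.Ventures.LatticeQCDFlow.Theory2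

open MeasureTheory ProbabilityTheory Filter Finset Real Set Complex
open scoped Topology NNReal

/-! ## §1 The truncated third-order bound on a characteristic function -/

section TruncatedBound

variable {Y : Type*} {mY : MeasurableSpace Y} (ρ : Measure Y) [IsProbabilityMeasure ρ] {h : Y → ℝ}

/-- **Lindeberg's per-block estimate**: for a centred square-integrable statistic `h` and every
truncation level `M ≥ 0`,
`‖φ(u) − (1 − u²·E h²/2)‖ ≤ |u|³·M·E h² + (3/2)·u²·E[h²; |h| > M]`. [ours] -/
theorem norm_charFun_map_sub_taylor_le_trunc (hm : Measurable h) (h2 : MemLp h 2 ρ)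
    (h0 : ∫ y, h y ∂ρ = 0) (u : ℝ) {M : ℝ} (hM : 0 ≤ M) :
    ‖charFun (ρ.map h) u - (1 - (u ^ 2 * (∫ y, h y ^ 2 ∂ρ) / 2 : ℝ) : ℂ)‖
      ≤ |u| ^ 3 * M * ∫ y, h y ^ 2 ∂ρ + 3 / 2 * u ^ 2 * ∫ y in {y | M < |h y|}, h y ^ 2 ∂ρ := by
  have hi : Integrable h ρ := h2.integrable one_le_two
  have hi2 : Integrable (fun y => h y ^ 2) ρ := h2.integrable_sq
  have hS : MeasurableSet {y | M < |h y|} := measurableSet_lt measurable_const hm.abs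
  -- the characteristic function as an integral over `ρ`
  have hcf : charFun (ρ.map h) u = ∫ y, Complex.exp (((u * h y : ℝ) : ℂ) * I) ∂ρ := by
    rw [charFun_apply_real, integral_map hm.aemeasurable (by fun_prop)]
    refine integral_congr_ae (ae_of_all _ fun y => ?_)
    push_cast; ring_nf
  -- the remainder and its pointwise bound
  set R : Y → ℂ := fun y => Complex.exp (((u * h y : ℝ) : ℂ) * I) - 1 - ((u * h y : ℝ) : ℂ) * I
    + (((u * h y : ℝ) : ℂ)) ^ 2 / 2 with hR
  have hRb : ∀ y, ‖R y‖ ≤ |u| ^ 3 * M * h y ^ 2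
      + 3 / 2 * u ^ 2 * Set.indicator {y | M < |h y|} (fun y => h y ^ 2) y := by
    intro y
    by_cases hy : M < |h y|
    · -- large values: the second-order bound `(3/2) x²`
      have hind : Set.indicator {y | M < |h y|} (fun y => h y ^ 2) y = h y ^ 2 :=
        Set.indicator_of_mem (by exact hy) _
      rw [hind]
      have h1 : ‖R y‖ ≤ 3 / 2 * (u * h y) ^ 2 := by
        calc ‖R y‖ ≤ ‖Complex.exp (((u * h y : ℝ) : ℂ) * I) - 1 - ((u * h y : ℝ) : ℂ) * I‖
              + ‖(((u * h y : ℝ) : ℂ)) ^ 2 / 2‖ := norm_add_le _ _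
          _ ≤ (u * h y) ^ 2 + (u * h y) ^ 2 / 2 := by
              refine add_le_add (norm_cexp_mul_I_sub_one_sub_le (u * h y)) (le_of_eq ?_)
              rw [norm_div, Complex.norm_pow, Complex.norm_real, Real.norm_eq_abs, sq_abs]
              simp
          _ = 3 / 2 * (u * h y) ^ 2 := by ring
      have h3 : 0 ≤ |u| ^ 3 * M * h y ^ 2 := by positivity
      nlinarith [h1, h3]
    · -- small values: the third-order bound `|x|³ ≤ |u|³ M h²`
      have hind : Set.indicator {y | M < |h y|} (fun y => h y ^ 2) y = 0 :=
        Set.indicator_of_notMem (by exact hy) _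
      rw [hind, mul_zero, add_zero]
      have hle : |h y| ≤ M := le_of_not_gt hy
      calc ‖R y‖ ≤ |u * h y| ^ 3 := norm_cexp_mul_I_sub_taylor_two_le (u * h y)
        _ = |u| ^ 3 * |h y| * h y ^ 2 := by rw [abs_mul, mul_pow, ← sq_abs (h y)]; ring
        _ ≤ |u| ^ 3 * M * h y ^ 2 := by
            refine mul_le_mul_of_nonneg_right ?_ (sq_nonneg _)
            exact mul_le_mul_of_nonneg_left hle (by positivity)
  -- integrability of the pieces
  have iE : Integrable (fun y => Complex.exp (((u * h y : ℝ) : ℂ) * I)) ρ := by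
    refine (integrable_const (1 : ℝ)).mono' (by fun_prop) (ae_of_all _ fun y => ?_)
    rw [Complex.norm_exp_ofReal_mul_I]
  have iL : Integrable (fun y => ((u * h y : ℝ) : ℂ) * I) ρ :=
    ((hi.const_mul u).ofReal).mul_const I
  have iQ : Integrable (fun y => (((u * h y : ℝ) : ℂ)) ^ 2 / 2) ρ := by
    have : Integrable (fun y => ((u ^ 2 * h y ^ 2 / 2 : ℝ) : ℂ)) ρ :=
      ((hi2.const_mul (u ^ 2)).div_const 2).ofReal
    refine this.congr (ae_of_all _ fun y => ?_)
    push_cast; ring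
  have i1 : Integrable (fun y => Complex.exp (((u * h y : ℝ) : ℂ) * I) - 1) ρ :=
    iE.sub' (integrable_const _)
  have i2 : Integrable (fun y => Complex.exp (((u * h y : ℝ) : ℂ) * I) - 1 - ((u * h y : ℝ) : ℂ) * I) ρ :=
    i1.sub' iL
  have hint : ∫ y, R y ∂ρ = charFun (ρ.map h) u - (1 - (u ^ 2 * (∫ y, h y ^ 2 ∂ρ) / 2 : ℝ) : ℂ) := by
    simp only [hR]
    rw [integral_add i2 iQ, integral_sub i1 iL, integral_sub iE (integrable_const _), hcf, integral_const]
    simp only [probReal_univ, one_smul]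
    have hlin : ∫ y, ((u * h y : ℝ) : ℂ) * I ∂ρ = 0 := by
      rw [integral_mul_const, integral_complex_ofReal, integral_const_mul, h0]; simp
    have hquad : ∫ y, (((u * h y : ℝ) : ℂ)) ^ 2 / 2 ∂ρ = ((u ^ 2 * (∫ y, h y ^ 2 ∂ρ) / 2 : ℝ) : ℂ) := by
      have e : (fun y => (((u * h y : ℝ) : ℂ)) ^ 2 / 2) = fun y => (((u ^ 2 * (h y ^ 2) / 2 : ℝ)) : ℂ) := by
        funext y; push_cast; ring
      rw [e, integral_complex_ofReal, integral_div, integral_const_mul]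
    rw [hlin, hquad]
    push_cast
    ring
  rw [← hint]
  have iB : Integrable (fun y => |u| ^ 3 * M * h y ^ 2
      + 3 / 2 * u ^ 2 * Set.indicator {y | M < |h y|} (fun y => h y ^ 2) y) ρ :=
    (hi2.const_mul _).add ((hi2.indicator hS).const_mul _)
  calc ‖∫ y, R y ∂ρ‖ ≤ ∫ y, ‖R y‖ ∂ρ := norm_integral_le_integral_norm _
    _ ≤ ∫ y, (|u| ^ 3 * M * h y ^ 2
          + 3 / 2 * u ^ 2 * Set.indicator {y | M < |h y|} (fun y => h y ^ 2) y) ∂ρ :=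
        integral_mono_of_nonneg (ae_of_all _ fun y => norm_nonneg _) iB (ae_of_all _ hRb)
    _ = |u| ^ 3 * M * ∫ y, h y ^ 2 ∂ρ + 3 / 2 * u ^ 2 * ∫ y in {y | M < |h y|}, h y ^ 2 ∂ρ := by
        rw [integral_add (hi2.const_mul _) ((hi2.indicator hS).const_mul _), integral_const_mul,
          integral_const_mul, integral_indicator hS]

/-- **Feller's bound from the truncation**: `E h² ≤ M² + E[h²; |h| > M]`. [folklore] -/
theorem integral_sq_le_sq_add_trunc (hm : Measurable h) (h2 : MemLp h 2 ρ) (M : ℝ) :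
    ∫ y, h y ^ 2 ∂ρ ≤ M ^ 2 + ∫ y in {y | M < |h y|}, h y ^ 2 ∂ρ := by
  have hi2 : Integrable (fun y => h y ^ 2) ρ := h2.integrable_sq
  have hS : MeasurableSet {y | M < |h y|} := measurableSet_lt measurable_const hm.abs
  rw [← integral_add_compl hS hi2, add_comm]
  refine add_le_add ?_ le_rfl
  calc ∫ y in {y | M < |h y|}ᶜ, h y ^ 2 ∂ρ ≤ ∫ y in {y | M < |h y|}ᶜ, M ^ 2 ∂ρ := by
        refine setIntegral_mono_on hi2.integrableOn (integrableOn_const) hS.compl fun y hy => ?_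
        have : |h y| ≤ M := le_of_not_gt hy
        rw [← sq_abs]; exact pow_le_pow_left₀ (abs_nonneg _) this 2
    _ ≤ M ^ 2 := by
        rw [setIntegral_const, smul_eq_mul]
        exact (mul_le_of_le_one_left (sq_nonneg _) (measureReal_le_one)).trans le_rfl

end TruncatedBound

end Summit.Ventures.LatticeQCDFlow.Theory2

end
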